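import Mathlib
import Summits.CriticalPhenomena.CardyFormulaZ2.Theorems.CardySelfRefinementDefs
import Summits.CriticalPhenomena.CardyFormulaZ2.Theorems.CardySelfRefinementGradientComparabilityStubSlopeBoundsCornerTransferCell
import Summits.CriticalPhenomena.CardyFormulaZ2.Theorems.CardySelfRefinementGradientComparabilityStubSlopeBoundsCornerTransferDead
import HarnessLib

/-!
# Crux `GradientComparability` (stmt-CriticalPhenomena-10269), line `monotone-product-coordinates` —
# stub `stub_cornerLocalSlope` (LOC), corner transfer (B″₃), part 1: the boundary ring of the
# `k = 3` cell

Route `CardySelfRefinement`, sub-problem `CriticalPhenomena/CardyFormulaZ2`; vocabulary from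
`CardySelfRefinementDefs` (`ax tb edgeOf dirVec`); the frame kit of `…StubNonAxialShareBulkFrames`
(`frame_adj`, `isPreconnected_openEdgeUnion_insert`, `meshPoint_mem_openEdgeUnion`,
`openEdgeUnion_singleton_eq`) and `mem_bundleSet_of` (`…StubSlopeBoundsCornerTransferCell`).

## Mathematics

For `k = 3` the coarse cell of base `z ∈ ℤ²` has the sixteen vertices `V a b = 3z + (a, b)`,
`0 ≤ a, b ≤ 3`; its INTERIOR block is `V a b`, `a, b ∈ {1, 2}` (the ends of its non-axial edges
that are not on a coarse line), and its boundary RING consists of the twelve sub-edges of its four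
side bundles `S = (z,0)` (row `b = 0`), `E = (z+e₀,1)` (column `a = 3`), `N = (z+e₁,0)` (row
`b = 3`), `W = (z,1)` (column `a = 0`), in the bundle currency
`edgeOf '' {vd | ax 3 vd ∧ tb 3 vd = t ∧ vd.2 = d}` of `Drho_eq_sum_half_pivotal_sub_defect`.
This file records the elementary facts used by the pointwise corner transfer for `k = 3`
(part 3, `exists_setPivotal_side_of_isPivotal_three`):
* `ring_subedges_mem_three` — the twelve ring sub-edges lie in the four side bundles;
* `ring_facts_three` — the drawing of the ring is preconnected, contains the drawn non-corner
  ring vertices, and every ring edge is a lattice edge with first vertex in the cell;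
* `frame_three_near`, `eq_frame_three` — cell vertices are within four steps of any interior
  vertex; every site has frame coordinates;
* `exit_mem_ring_three` — a lattice neighbour of an interior vertex outside the interior block is
  drawn on the ring;
* `interior_edge_notMem_bundleSet_three` — no edge at an interior vertex lies in any bundle.
-/

noncomputable section

namespace Summit.CriticalPhenomena.CardyFormulaZ2.Theorems.CardySelfRefinement

open scoped Topology
open Filter Set MeasureTheory
open Literature.Probability.LatticeModels Literature.Probability.Percolation
open Literature.Probability.Percolation.QuadCrossing
open Summit.CriticalPhenomena.CardyFormulaZ2.Theses.CardySelfRefinement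

/-! ## The twelve ring sub-edges lie in the four side bundles -/

/-- **The ring sub-edges of the `k = 3` cell lie in its side bundles.**  In the frame
`V a b = 3z + a e₀ + b e₁` of the cell of base `z`, for `0 ≤ j ≤ 2`: `V j 0—V j+1 0 ∈ S = (z,0)`,
`V 3 j—V 3 j+1 ∈ E = (z+e₀,1)`, `V j 3—V j+1 3 ∈ N = (z+e₁,0)`, `V 0 j—V 0 j+1 ∈ W = (z,1)`. -/
theorem ring_subedges_mem_three {k : ℕ} (hk : k = 3) (z : Site 2)
    {V : ℤ → ℤ → Site 2} (hV : ∀ a b, V a b = ![(k : ℤ) * z 0, (k : ℤ) * z 1] + a • ![1, 0] + b • ![0, 1])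
    (j : ℤ) (hj0 : 0 ≤ j) (hj2 : j ≤ 2) :
    s(V j 0, V (j + 1) 0) ∈ edgeOf '' {vd : Site 2 × Fin 2 | ax k vd ∧ tb k vd = z ∧ vd.2 = 0} ∧
    s(V 3 j, V 3 (j + 1)) ∈ edgeOf '' {vd : Site 2 × Fin 2 | ax k vd ∧ tb k vd = z + Pi.single 0 1 ∧ vd.2 = 1} ∧
    s(V j 3, V (j + 1) 3) ∈ edgeOf '' {vd : Site 2 × Fin 2 | ax k vd ∧ tb k vd = z + Pi.single 1 1 ∧ vd.2 = 0} ∧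
    s(V 0 j, V 0 (j + 1)) ∈ edgeOf '' {vd : Site 2 × Fin 2 | ax k vd ∧ tb k vd = z ∧ vd.2 = 1} := by
  subst hk
  have hdv : ∀ i : Fin 2, (dirVec i : Site 2) = Pi.single i 1 := fun i => dirVec_eq_single i
  have key : ∀ (a b : ℤ) (d : Fin 2) (t : Site 2), ((3 : ℕ) : ℤ) ∣ V a b (if d = 0 then 1 else 0) →
      (fun i => V a b i / ((3 : ℕ) : ℤ)) = t →
      s(V a b, V a b + dirVec d) ∈ edgeOf '' {vd : Site 2 × Fin 2 | ax 3 vd ∧ tb 3 vd = t ∧ vd.2 = d} :=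
    fun a b d t hax htb => mem_bundleSet_of hax htb rfl
  have hstep0 : ∀ a b : ℤ, V a b + dirVec 0 = V (a + 1) b := fun a b => by
    funext l; fin_cases l <;> simp [hV, hdv]; all_goals ring
  have hstep1 : ∀ a b : ℤ, V a b + dirVec 1 = V a (b + 1) := fun a b => by
    funext l; fin_cases l <;> simp [hV, hdv]; all_goals ring
  refine ⟨?_, ?_, ?_, ?_⟩
  · have h := key j 0 0 z (by simp [hV]) (by funext l; fin_cases l <;> simp [hV]; all_goals omega)
    rwa [hstep0] at h
  · have h := key 3 j 1 (z + Pi.single 0 1) (by simp [hV])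
      (by funext l; fin_cases l <;> simp [hV]; all_goals omega)
    rwa [hstep1] at h
  · have h := key j 3 0 (z + Pi.single 1 1) (by simp [hV])
      (by funext l; fin_cases l <;> simp [hV]; all_goals omega)
    rwa [hstep0] at h
  · have h := key 0 j 1 z (by simp [hV]) (by funext l; fin_cases l <;> simp [hV]; all_goals omega)
    rwa [hstep1] at h

/-! ## The ring as a drawn cycle -/

/-- **The boundary ring of the `k = 3` cell.**  In a frame `V a b = c + a e₀ + b e₁`, the twelve
sub-edges of the square `V 0 0 → V 3 0 → V 3 3 → V 0 3 → V 0 0` have a preconnected drawing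
containing the drawn non-corner ring vertices `V 0 b, V 3 b` (`b = 1, 2`), `V a 0, V a 3`
(`a = 1, 2`), and each of them is a lattice edge `{V a b, V a' b'}` with `0 ≤ a, b ≤ 3`. -/
theorem ring_facts_three {c : Site 2} {V : ℤ → ℤ → Site 2}
    (hV : ∀ a b, V a b = c + a • ![1, 0] + b • ![0, 1]) (δ : ℝ) :
    IsPreconnected (openEdgeUnion δ ({s(V 0 0, V 1 0), s(V 1 0, V 2 0), s(V 2 0, V 3 0), s(V 3 0, V 3 1),
      s(V 3 1, V 3 2), s(V 3 2, V 3 3), s(V 3 3, V 2 3), s(V 2 3, V 1 3), s(V 1 3, V 0 3), s(V 0 3, V 0 2),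
      s(V 0 2, V 0 1), s(V 0 1, V 0 0)} : Set (Sym2 (Site 2)))) ∧
    (∀ a b : ℤ, ((a = 0 ∨ a = 3) ∧ (b = 1 ∨ b = 2)) ∨ ((b = 0 ∨ b = 3) ∧ (a = 1 ∨ a = 2)) →
      meshPoint δ (V a b) ∈ openEdgeUnion δ ({s(V 0 0, V 1 0), s(V 1 0, V 2 0), s(V 2 0, V 3 0), s(V 3 0, V 3 1),
      s(V 3 1, V 3 2), s(V 3 2, V 3 3), s(V 3 3, V 2 3), s(V 2 3, V 1 3), s(V 1 3, V 0 3), s(V 0 3, V 0 2),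
      s(V 0 2, V 0 1), s(V 0 1, V 0 0)} : Set (Sym2 (Site 2)))) ∧
    (∀ f ∈ ({s(V 0 0, V 1 0), s(V 1 0, V 2 0), s(V 2 0, V 3 0), s(V 3 0, V 3 1),
      s(V 3 1, V 3 2), s(V 3 2, V 3 3), s(V 3 3, V 2 3), s(V 2 3, V 1 3), s(V 1 3, V 0 3), s(V 0 3, V 0 2),
      s(V 0 2, V 0 1), s(V 0 1, V 0 0)} : Set (Sym2 (Site 2))),
      ∃ a b a' b' : ℤ, f = s(V a b, V a' b') ∧ (zdGraph 2).Adj (V a b) (V a' b') ∧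
        0 ≤ a ∧ a ≤ 3 ∧ 0 ≤ b ∧ b ≤ 3) := by
  have hfr : (((![1, 0] : Site 2) = ![1, 0] ∨ (![1, 0] : Site 2) = ![-1, 0]) ∧
      ((![0, 1] : Site 2) = ![0, 1] ∨ (![0, 1] : Site 2) = ![0, -1])) ∨
      (((![1, 0] : Site 2) = ![0, 1] ∨ (![1, 0] : Site 2) = ![0, -1]) ∧
      ((![0, 1] : Site 2) = ![1, 0] ∨ (![0, 1] : Site 2) = ![-1, 0])) := Or.inl ⟨Or.inl rfl, Or.inl rfl⟩
  have hadj : ∀ {a b a' b' : ℤ}, (a' = a + 1 ∧ b' = b) ∨ (a' = a - 1 ∧ b' = b) ∨ (a' = a ∧ b' = b + 1) ∨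
      (a' = a ∧ b' = b - 1) → (zdGraph 2).Adj (V a b) (V a' b') := fun h => frame_adj hV hfr h
  refine ⟨?_, ?_, ?_⟩
  · refine isPreconnected_openEdgeUnion_insert δ (hadj (by norm_num)) ?_
      (isPreconnected_openEdgeUnion_insert δ (hadj (by norm_num)) ?_
      (isPreconnected_openEdgeUnion_insert δ (hadj (by norm_num)) ?_
      (isPreconnected_openEdgeUnion_insert δ (hadj (by norm_num)) ?_
      (isPreconnected_openEdgeUnion_insert δ (hadj (by norm_num)) ?_
      (isPreconnected_openEdgeUnion_insert δ (hadj (by norm_num)) ?_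
      (isPreconnected_openEdgeUnion_insert δ (hadj (by norm_num)) ?_
      (isPreconnected_openEdgeUnion_insert δ (hadj (by norm_num)) ?_
      (isPreconnected_openEdgeUnion_insert δ (hadj (by norm_num)) ?_
      (isPreconnected_openEdgeUnion_insert δ (hadj (by norm_num)) ?_
      (isPreconnected_openEdgeUnion_insert δ (hadj (by norm_num)) ?_ ?_))))))))))
    · exact meshPoint_mem_openEdgeUnion δ (c := V 2 0) (hadj (by norm_num)) (by simp)
    · exact meshPoint_mem_openEdgeUnion δ (c := V 3 0) (hadj (by norm_num)) (by simp)
    · exact meshPoint_mem_openEdgeUnion δ (c := V 3 1) (hadj (by norm_num)) (by simp)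
    · exact meshPoint_mem_openEdgeUnion δ (c := V 3 2) (hadj (by norm_num)) (by simp)
    · exact meshPoint_mem_openEdgeUnion δ (c := V 3 3) (hadj (by norm_num)) (by simp)
    · exact meshPoint_mem_openEdgeUnion δ (c := V 2 3) (hadj (by norm_num)) (by simp)
    · exact meshPoint_mem_openEdgeUnion δ (c := V 1 3) (hadj (by norm_num)) (by simp)
    · exact meshPoint_mem_openEdgeUnion δ (c := V 0 3) (hadj (by norm_num)) (by simp)
    · exact meshPoint_mem_openEdgeUnion δ (c := V 0 2) (hadj (by norm_num)) (by simp)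
    · exact meshPoint_mem_openEdgeUnion δ (c := V 0 1) (hadj (by norm_num)) (by simp)
    · exact meshPoint_mem_openEdgeUnion δ (c := V 0 0) (hadj (by norm_num)) (by simp)
    · rw [openEdgeUnion_singleton_eq δ (hadj (by norm_num))]
      exact (convex_segment _ _).isPreconnected
  · rintro a b (⟨rfl | rfl, rfl | rfl⟩ | ⟨rfl | rfl, rfl | rfl⟩)
    · exact meshPoint_mem_openEdgeUnion δ (c := V 0 0) (hadj (by norm_num)) (by simp)
    · exact meshPoint_mem_openEdgeUnion δ (c := V 0 1) (hadj (by norm_num)) (by simp)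
    · exact meshPoint_mem_openEdgeUnion δ (c := V 3 2) (hadj (by norm_num)) (by simp)
    · exact meshPoint_mem_openEdgeUnion δ (c := V 3 3) (hadj (by norm_num)) (by simp)
    · exact meshPoint_mem_openEdgeUnion δ (c := V 2 0) (hadj (by norm_num)) (by simp)
    · exact meshPoint_mem_openEdgeUnion δ (c := V 3 0) (hadj (by norm_num)) (by simp)
    · exact meshPoint_mem_openEdgeUnion δ (c := V 0 3) (hadj (by norm_num)) (by simp)
    · exact meshPoint_mem_openEdgeUnion δ (c := V 1 3) (hadj (by norm_num)) (by simp)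
  · intro f hf
    simp only [Set.mem_insert_iff, Set.mem_singleton_iff] at hf
    rcases hf with rfl | rfl | rfl | rfl | rfl | rfl | rfl | rfl | rfl | rfl | rfl | rfl
    · exact ⟨_, _, _, _, rfl, hadj (by norm_num), by norm_num⟩
    · exact ⟨_, _, _, _, rfl, hadj (by norm_num), by norm_num⟩
    · exact ⟨_, _, _, _, rfl, hadj (by norm_num), by norm_num⟩
    · exact ⟨_, _, _, _, rfl, hadj (by norm_num), by norm_num⟩
    · exact ⟨_, _, _, _, rfl, hadj (by norm_num), by norm_num⟩
    · exact ⟨_, _, _, _, rfl, hadj (by norm_num), by norm_num⟩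
    · exact ⟨_, _, _, _, rfl, hadj (by norm_num), by norm_num⟩
    · exact ⟨_, _, _, _, rfl, hadj (by norm_num), by norm_num⟩
    · exact ⟨_, _, _, _, rfl, hadj (by norm_num), by norm_num⟩
    · exact ⟨_, _, _, _, rfl, hadj (by norm_num), by norm_num⟩
    · exact ⟨_, _, _, _, rfl, hadj (by norm_num), by norm_num⟩
    · exact ⟨_, _, _, _, rfl, hadj (by norm_num), by norm_num⟩

/-! ## Frame coordinates in the `k = 3` cell -/

/-- Every site has frame coordinates: `u = V (u₀ − c₀) (u₁ − c₁)`. -/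
theorem eq_frame_three {c₀ c₁ : ℤ} {V : ℤ → ℤ → Site 2}
    (hV : ∀ a b, V a b = ![c₀, c₁] + a • ![1, 0] + b • ![0, 1]) (u : Site 2) : u = V (u 0 - c₀) (u 1 - c₁) := by
  funext l
  fin_cases l <;> simp [hV]

/-- The cell vertices `V a b`, `0 ≤ a, b ≤ 3`, are within four steps (indeed two) of every
interior vertex `x ∈ 3z + {1,2}²`. -/
theorem frame_three_near {k : ℕ} (hk : k = 3) (z : Site 2)
    {V : ℤ → ℤ → Site 2} (hV : ∀ a b, V a b = ![(k : ℤ) * z 0, (k : ℤ) * z 1] + a • ![1, 0] + b • ![0, 1])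
    {x : Site 2} (hx : ∀ l, x l = (k : ℤ) * z l + 1 ∨ x l = (k : ℤ) * z l + 2)
    (a b : ℤ) (ha : 0 ≤ a) (ha' : a ≤ 3) (hb : 0 ≤ b) (hb' : b ≤ 3) : ∀ i, |V a b i - x i| ≤ 4 := by
  subst hk
  have hx0 := hx 0
  have hx1 := hx 1
  intro i
  rw [abs_le]
  fin_cases i
  · simp [hV]; omega
  · simp [hV]; omega

/-- Two interior vertices of the cell are within sup-distance `1`. -/
theorem interior_coord_sub_le_three {k : ℕ} (hk : k = 3) (z : Site 2) {u x : Site 2}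
    (hu : ∀ l, u l = (k : ℤ) * z l + 1 ∨ u l = (k : ℤ) * z l + 2)
    (hx : ∀ l, x l = (k : ℤ) * z l + 1 ∨ x l = (k : ℤ) * z l + 2) (l : Fin 2) : |u l - x l| ≤ 1 := by
  subst hk
  rw [abs_le]
  rcases hu l with h | h <;> rcases hx l with h' | h' <;> rw [h, h'] <;> constructor <;> linarith

/-! ## Leaving the interior block lands on the ring -/

/-- **An exit from the interior block is a ring vertex.**  If `u` is an interior vertex of the
`k = 3` cell of base `z`, `y` a lattice neighbour of `u` which is NOT an interior vertex, then
the drawn `y` lies on the drawing of the boundary ring (it is a non-corner ring vertex). -/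
theorem exit_mem_ring_three {k : ℕ} (hk : k = 3) (z : Site 2)
    {V : ℤ → ℤ → Site 2} (hV : ∀ a b, V a b = ![(k : ℤ) * z 0, (k : ℤ) * z 1] + a • ![1, 0] + b • ![0, 1])
    (δ : ℝ) {u y : Site 2} (hu : ∀ l, u l = (k : ℤ) * z l + 1 ∨ u l = (k : ℤ) * z l + 2)
    (huy : (zdGraph 2).Adj u y) (hy : ¬ ∀ l, y l = (k : ℤ) * z l + 1 ∨ y l = (k : ℤ) * z l + 2) :
    meshPoint δ y ∈ openEdgeUnion δ ({s(V 0 0, V 1 0), s(V 1 0, V 2 0), s(V 2 0, V 3 0), s(V 3 0, V 3 1),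
      s(V 3 1, V 3 2), s(V 3 2, V 3 3), s(V 3 3, V 2 3), s(V 2 3, V 1 3), s(V 1 3, V 0 3), s(V 0 3, V 0 2),
      s(V 0 2, V 0 1), s(V 0 1, V 0 0)} : Set (Sym2 (Site 2))) := by
  subst hk
  obtain ⟨-, hring, -⟩ := ring_facts_three hV δ
  have hyV : y = V (y 0 - ((3 : ℕ) : ℤ) * z 0) (y 1 - ((3 : ℕ) : ℤ) * z 1) :=
    eq_frame_three hV y
  rw [hyV]
  apply hring
  push Not at hy
  obtain ⟨l, hl1, hl2⟩ := hy
  rw [zdGraph_two_adj_iff] at huy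
  have h0 := hu 0
  have h1 := hu 1
  push_cast at h0 h1 hl1 hl2 ⊢
  fin_cases l <;> simp only [Fin.zero_eta, Fin.isValue, Fin.mk_one] at hl1 hl2 <;> omega

/-! ## No edge at an interior vertex is axial -/

/-- **No edge at an interior vertex lies in a bundle**: if both coordinates of `x` are `≡ 1, 2`
modulo `3` (relative to the cell of base `z`), an edge `{x, y}` is in no bundle
`edgeOf '' {vd | ax 3 vd ∧ tb 3 vd = t ∧ vd.2 = d}` (both ends of an axial edge lie on a coarse
line). -/
theorem interior_edge_notMem_bundleSet_three : ∀ (k : ℕ), k = 3 → ∀ (z x : Site 2), (∀ l, x l = (k : ℤ) * z l + 1 ∨ x l = (k : ℤ) * z l + 2) → ∀ (y t : Site 2) (d : Fin 2), s(x, y) ∉ edgeOf '' {vd : Site 2 × Fin 2 | ax k vd ∧ tb k vd = t ∧ vd.2 = d} := by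
  intro k hk z x hx y t d
  subst hk
  rintro ⟨⟨v, d'⟩, ⟨hax, -, -⟩, he⟩
  have hdv : (dirVec d' : Site 2) = Pi.single d' 1 := dirVec_eq_single d'
  have hax' : ((3 : ℕ) : ℤ) ∣ v (if d' = 0 then 1 else 0) := hax
  have hne : (if d' = 0 then (1 : Fin 2) else 0) ≠ d' := by fin_cases d' <;> decide
  have hxl := hx (if d' = 0 then 1 else 0)
  rcases eq_or_eq_of_sym2_eq he.symm with h | h
  · have h1 : x (if d' = 0 then 1 else 0) = v (if d' = 0 then 1 else 0) := by rw [h]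
    rw [h1] at hxl
    rcases hxl with e | e <;> rw [e] at hax' <;> omega
  · have h1 : x (if d' = 0 then 1 else 0) = v (if d' = 0 then 1 else 0) := by
      rw [h]
      simp only [Pi.add_apply, hdv, Pi.single_apply]
      rw [if_neg hne, add_zero]
    rw [h1] at hxl
    rcases hxl with e | e <;> rw [e] at hax' <;> omega

/-! ## Open paths inside the interior block: walks and their drawings -/

/-- The vertices reachable through edges of `T` from a vertex of `I` lie in `I`, when every edge
of `T` has both ends in `I`. -/
theorem mem_of_reachable_fromEdgeSet {T : Set (Sym2 (Site 2))} {I : Set (Site 2)}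
    (hTI : ∀ f ∈ T, ∀ u ∈ f, u ∈ I) {v u : Site 2} (hv : v ∈ I)
    (h : (SimpleGraph.fromEdgeSet T).Reachable v u) : u ∈ I := by
  obtain ⟨p⟩ := h
  induction p with
  | nil => exact hv
  | cons h' _ ih => exact ih (hTI _ ((SimpleGraph.fromEdgeSet_adj T).1 h').1 _ (Sym2.mem_mk_right _ _))

/-- **A walk plus an exit edge is a drawn-connected patch.**  For a walk `a → b` in the graph of a
set `T` of lattice edges and a lattice edge `{b, y}`, the edges of the walk together with `{b, y}`
have a preconnected drawing containing the drawn `a` and the drawn `y`, and the walk edges lie in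
`T`. -/
theorem walk_patch_facts (δ : ℝ) {T : Set (Sym2 (Site 2))} (hT : T ⊆ (zdGraph 2).edgeSet) :
    ∀ {a b : Site 2} (p : (SimpleGraph.fromEdgeSet T).Walk a b) {y : Site 2}, (zdGraph 2).Adj b y →
      IsPreconnected (openEdgeUnion δ (insert s(b, y) {f | f ∈ p.edges})) ∧
      meshPoint δ a ∈ openEdgeUnion δ (insert s(b, y) {f | f ∈ p.edges}) ∧
      meshPoint δ y ∈ openEdgeUnion δ (insert s(b, y) {f | f ∈ p.edges}) ∧
      {f | f ∈ p.edges} ⊆ T := by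
  intro a b p
  induction p with
  | @nil u =>
    intro y hy
    have hset : {f : Sym2 (Site 2) | f ∈ (SimpleGraph.Walk.nil : (SimpleGraph.fromEdgeSet T).Walk u u).edges} = ∅ := by
      ext f
      simp
    rw [hset, insert_empty_eq]
    refine ⟨?_, meshPoint_mem_openEdgeUnion δ hy rfl, ?_, Set.empty_subset _⟩
    · rw [openEdgeUnion_singleton_eq δ hy]
      exact (convex_segment _ _).isPreconnected
    · exact segment_subset_openEdgeUnion' δ hy (Set.mem_singleton _) (right_mem_segment ℝ _ _)
  | @cons u v w h p ih =>
    intro y hy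
    have huvT : s(u, v) ∈ T := ((SimpleGraph.fromEdgeSet_adj T).1 h).1
    have huv : (zdGraph 2).Adj u v := (SimpleGraph.mem_edgeSet _).1 (hT huvT)
    have hset : insert s(w, y) {f : Sym2 (Site 2) | f ∈ (SimpleGraph.Walk.cons h p).edges} =
        insert s(u, v) (insert s(w, y) {f | f ∈ p.edges}) := by
      ext f
      simp only [SimpleGraph.Walk.edges_cons, List.mem_cons, Set.mem_insert_iff, Set.mem_setOf_eq]
      tauto
    obtain ⟨ih1, ih2, ih3, ih4⟩ := ih hy
    rw [hset]
    refine ⟨isPreconnected_openEdgeUnion_insert δ huv ih2 ih1, meshPoint_mem_openEdgeUnion δ huv (Set.mem_insert _ _),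
      openEdgeUnion_mono δ (Set.subset_insert _ _) ih3, fun f hf => ?_⟩
    simp only [SimpleGraph.Walk.edges_cons, List.mem_cons, Set.mem_setOf_eq] at hf
    rcases hf with rfl | hf
    exacts [huvT, ih4 hf]

/-- **The open cluster behind a pivotal edge escapes the interior block** (step (1) of the
pointwise corner transfer for `k = 3`).  Let `I` be a set of sites pairwise within sup-distance
`1`, `T` a set of edges with both ends in `I` containing every `ω`-open lattice edge inside `I`
other than `{a, v}`, `v ∈ I` drawn `r`-far from every quad side (`8η ≤ r`), `{a, v}` a lattice
edge pivotal for `Aloc m F η` at `ω`, and `a` NOT reachable from `v` through `T`.  Then some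
`v'` reachable from `v` through `T` has an `ω`-open lattice edge `{v', y} ≠ {a, v}` to a site
`y ∉ I` (`exists_adj_notMem_of_isPivotal` applied to the `T`-cluster of `v`, which is closed
under open edges inside `I`). -/
theorem exists_exit_of_isPivotal (m : ℕ) (F : Fin m → Quad (Set.univ : Set ℂ)) {η r : ℝ}
    (hη : 0 < η) (h8 : 8 * η ≤ r) {ω : BondConfig (Site 2)} {T : Set (Sym2 (Site 2))} {I : Set (Site 2)}
    (hI : ∀ u ∈ I, ∀ u' ∈ I, ∀ l, |u l - u' l| ≤ 1) (hTI : ∀ f ∈ T, ∀ u ∈ f, u ∈ I) {a v : Site 2}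
    (hT : ∀ x y : Site 2, (zdGraph 2).Adj x y → x ∈ I → y ∈ I → s(x, y) ∈ ω → s(x, y) ≠ s(a, v) → s(x, y) ∈ T)
    (hav : (zdGraph 2).Adj a v) (hv : v ∈ I) (ha : ¬ (SimpleGraph.fromEdgeSet T).Reachable v a)
    (hfar : ∀ (i : Fin m) (j : Fin 4), ∀ p ∈ (F i).side j, r ≤ dist ((η : ℂ) * squareLatticeEmbedding.z v) p)
    (hpiv : IsPivotal (Aloc m F η) s(a, v) ω) :
    ∃ v' y : Site 2, (SimpleGraph.fromEdgeSet T).Reachable v v' ∧ v' ∈ I ∧ y ∉ I ∧ (zdGraph 2).Adj v' y ∧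
      s(v', y) ∈ ω ∧ s(v', y) ≠ s(a, v) := by
  set C : Set (Site 2) := {u | (SimpleGraph.fromEdgeSet T).Reachable v u} with hC
  have hvC : v ∈ C := SimpleGraph.Reachable.refl v
  have hCI : C ⊆ I := fun u hu => mem_of_reachable_fromEdgeSet hTI hv hu
  have hCnear : ∀ x ∈ C, ∀ l, |x l - v l| ≤ ((1 : ℕ) : ℤ) := fun x hx l => by
    exact_mod_cast hI x (hCI hx) v hv l
  have h8' : (4 * ((1 : ℕ) : ℝ) + 4) * η ≤ r := by norm_num; linarith
  obtain ⟨x, hxC, y, hyC, hxy, hω, hne⟩ :=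
    exists_adj_notMem_of_isPivotal m F η r hη 1 h8' ω C a v hav hvC ha hCnear hfar hpiv
  refine ⟨x, y, hxC, hCI hxC, fun hyI => hyC ?_, hxy, hω, hne⟩
  exact SimpleGraph.Reachable.trans hxC (SimpleGraph.Adj.reachable
    ((SimpleGraph.fromEdgeSet_adj T).2 ⟨hT x y hxy (hCI hxC) hyI hω hne, hxy.ne⟩))

end Summit.CriticalPhenomena.CardyFormulaZ2.Theorems.CardySelfRefinement

end
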